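import Summits.KontsevichZagierPeriods.KontsevichZagierPeriods.Theorems.HurwitzMicroSectorsNormalFormPrincipleM2FiveZetaTwo
import Literature.NumberTheory.Transcendental.KZProductIdeal

/-!
# `NormalFormPrinciple` (stmt-KontsevichZagierPeriods-3869), line `SketchIdeator1` — leaf `stub_boxRigidity`,
# dimension two off the product type (`CatalanTwoWays`, half-angle/Möbius/Catalan side): the Catalan-side representations exist

Registered sub-goal `exists_catalanReps` of the layer `CatalanTwoWays`: the three honest
Kontsevich–Zagier integral representations on the Catalan side of the chain exist.

* `C₀ = [band-box {0 < x < 1, 0 ≤ y ≤ 1}, 1/(1 + x²y²)]`: the integrand is a quotient of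
  `ℚ`-polynomials with denominator `≥ 1`, continuous on the compact cube `[0,1]² ⊇ band-box`.
* `C₁ = [triangle {0 < x < 1, 0 ≤ z ≤ x}, 1/(x(1 + z²))]`: the integrand is unbounded near
  `x = 0`, but its fibre integrals `∫₀ˣ dz/(x(1 + z²)) ≤ 1` are bounded, so Tonelli along the last
  coordinate (`KZlog.integrableOn_band_of_lintegral_fibre_le`) gives absolute convergence.
* `K' = [wedge {0 < u < 1, u ≤ y ≤ 1}, 1/((1 + u²)y)]`: the coordinate swap of `C₁`
  (`KZ.IntegralRep.reindex`, a measure-preserving relabelling) plus the null edge `y = 1`.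

References: M. Kontsevich, D. Zagier, *Periods* (2001), §1.1–1.2. No new definitions.
-/

noncomputable section

open MeasureTheory Set
open Literature.NumberTheory.Transcendental Literature.NumberTheory.Transcendental.KZ
open Literature.ModelTheory.ExponentialFields (IsSemialgebraic)

namespace Summit.KontsevichZagierPeriods.HurwitzMicroSectors.NormalFormPrinciple.PiBox.M2

/-- **`C₀ = [band-box, 1/(1 + x²y²)]` exists**: the integrand is a quotient of `ℚ`-polynomials
whose denominator is `≥ 1`, so it is `ℚ`-semialgebraic on the band-box and continuous on the
compact cube `[0,1]² ⊇ band-box`, hence absolutely integrable.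
[cite: KontsevichZagier2001, §1.1] -/
theorem exists_catalanRep_bandBox :
    ∃ C₀ : IntegralRep 2,
      C₀.domain =
          KZlog.band {y : Fin 1 → ℝ | 0 < y 0 ∧ y 0 < 1} (fun _ => (0:ℝ)) (fun _ => (1:ℝ)) ∧
        C₀.integrand = fun z => 1 / (1 + (z 0 * z 1) ^ 2) := by
  have hB := isSemialgebraic_bandBox
  have hpos : ∀ z : Fin 2 → ℝ, (0:ℝ) < 1 + (z 0 * z 1) ^ 2 := fun z => by positivity
  have hsa : IsSemialgebraicFunOn ℚ
      (KZlog.band {y : Fin 1 → ℝ | 0 < y 0 ∧ y 0 < 1} (fun _ => (0:ℝ)) (fun _ => (1:ℝ)))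
      (fun z => 1 / (1 + (z 0 * z 1) ^ 2)) := by
    refine (isSemialgebraicFunOn_aeval_div_aeval hB 1
      (1 + (MvPolynomial.X 0 * MvPolynomial.X 1) ^ 2) fun x _ => ?_).congr fun x _ => by simp
    simp only [map_add, map_mul, map_pow, map_one, MvPolynomial.aeval_X]
    exact (hpos x).ne'
  have hcont : Continuous fun z : Fin 2 → ℝ => 1 / (1 + (z 0 * z 1) ^ 2) :=
    continuous_const.div (by fun_prop) fun z => (hpos z).ne'
  have hint : IntegrableOn (fun z : Fin 2 → ℝ => 1 / (1 + (z 0 * z 1) ^ 2))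
      (KZlog.band {y : Fin 1 → ℝ | 0 < y 0 ∧ y 0 < 1} (fun _ => (0:ℝ)) (fun _ => (1:ℝ))) :=
    (hcont.continuousOn.integrableOn_compact isCompact_Icc).mono_set bandBox_subset_Icc
  exact ⟨⟨_, _, hB, hsa, hint⟩, rfl, rfl⟩

/-- **`C₁ = [triangle {0 < x < 1, 0 ≤ z ≤ x}, 1/(x(1 + z²))]` exists**: the triangle is a band
over the open unit interval with `ℚ`-semialgebraic edges `0 ≤ z ≤ x`; the integrand is a quotient
of `ℚ`-polynomials with denominator `x(1 + z²) > 0` on the triangle; and its fibre integrals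
`∫₀ˣ dz/(x(1 + z²)) ≤ ∫₀ˣ dz/x = 1` are bounded by the constant `1`, integrable on the base, so the
integrand is absolutely integrable by Tonelli along the last coordinate
(`KZlog.integrableOn_band_of_lintegral_fibre_le`). [cite: KontsevichZagier2001, §1.1] -/
theorem exists_catalanRep_triangle :
    ∃ C₁ : IntegralRep 2,
      C₁.domain =
          KZlog.band {y : Fin 1 → ℝ | 0 < y 0 ∧ y 0 < 1} (fun _ => (0:ℝ)) (fun y => y 0) ∧
        C₁.integrand = fun z => 1 / (z 0 * (1 + z 1 ^ 2)) := by
  have hσ : IsSemialgebraic ℚ {y : Fin 1 → ℝ | 0 < y 0 ∧ y 0 < 1} :=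
    isSemialgebraic_unitInterval_fin_one
  have hT : IsSemialgebraic ℚ
      (KZlog.band {y : Fin 1 → ℝ | 0 < y 0 ∧ y 0 < 1} (fun _ => (0:ℝ)) (fun y => y 0)) :=
    KZlog.isSemialgebraic_band (by simpa using isSemialgebraicFunOn_ratCast hσ 0)
      (isSemialgebraicFunOn_apply hσ 0)
  have hmem : ∀ z : Fin 2 → ℝ,
      z ∈ KZlog.band {y : Fin 1 → ℝ | 0 < y 0 ∧ y 0 < 1} (fun _ => (0:ℝ)) (fun y => y 0) ↔
        (0 < z 0 ∧ z 0 < 1) ∧ 0 ≤ z 1 ∧ z 1 ≤ z 0 := fun z => Iff.rfl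
  have hsa : IsSemialgebraicFunOn ℚ
      (KZlog.band {y : Fin 1 → ℝ | 0 < y 0 ∧ y 0 < 1} (fun _ => (0:ℝ)) (fun y => y 0))
      (fun z => 1 / (z 0 * (1 + z 1 ^ 2))) := by
    refine (isSemialgebraicFunOn_aeval_div_aeval hT 1
      (MvPolynomial.X 0 * (1 + MvPolynomial.X 1 ^ 2)) fun z hz => ?_).congr fun z _ => by simp
    have h := (hmem z).1 hz
    have h1 : (0:ℝ) < 1 + z 1 ^ 2 := by positivity
    simp only [map_add, map_mul, map_pow, map_one, MvPolynomial.aeval_X]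
    exact (mul_pos h.1.1 h1).ne'
  have hTm : MeasurableSet
      (KZlog.band {y : Fin 1 → ℝ | 0 < y 0 ∧ y 0 < 1} (fun _ => (0:ℝ)) (fun y => y 0)) :=
    Literature.ModelTheory.ExponentialFields.IsSemialgebraic.measurableSet_holds hT
  have hσm : MeasurableSet {y : Fin 1 → ℝ | 0 < y 0 ∧ y 0 < 1} :=
    Literature.ModelTheory.ExponentialFields.IsSemialgebraic.measurableSet_holds hσ
  -- the constant fibre bound `1` is integrable on the base `(0,1) ⊆ [0,1]`
  have hσIcc : {y : Fin 1 → ℝ | 0 < y 0 ∧ y 0 < 1} ⊆ Icc (0 : Fin 1 → ℝ) 1 := fun y hy =>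
    ⟨fun i => by fin_cases i; exact hy.1.le, fun i => by fin_cases i; exact hy.2.le⟩
  have hK : IntegrableOn (fun _ : Fin 1 → ℝ => (1:ℝ)) {y : Fin 1 → ℝ | 0 < y 0 ∧ y 0 < 1} :=
    (integrableOn_const (isCompact_Icc.measure_lt_top).ne).mono_set hσIcc
  have hs0 : ∀ (x : Fin 1 → ℝ) (t : ℝ), (Fin.snoc x t : Fin 2 → ℝ) 0 = x 0 := fun _ _ => rfl
  have hs1 : ∀ (x : Fin 1 → ℝ) (t : ℝ), (Fin.snoc x t : Fin 2 → ℝ) 1 = t := fun _ _ => rfl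
  have hint : IntegrableOn (fun z : Fin 2 → ℝ => 1 / (z 0 * (1 + z 1 ^ 2)))
      (KZlog.band {y : Fin 1 → ℝ | 0 < y 0 ∧ y 0 < 1} (fun _ => (0:ℝ)) (fun y => y 0)) := by
    refine KZlog.integrableOn_band_of_lintegral_fibre_le hσm hTm (fun x t => KZlog.snoc_mem_band)
      (aestronglyMeasurable_of_isSemialgebraicFunOn hsa hTm) (K := fun _ => (1:ℝ))
      (fun x hx => ?_) hK
    have hx0 : 0 < x 0 := hx.1
    -- on the fibre over `x`, `1/(x(1 + t²)) ≤ 1/x`, and `∫₀ˣ dt/x = 1`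
    calc ∫⁻ t in Icc (0:ℝ) (x 0), ‖1 / ((Fin.snoc x t : Fin 2 → ℝ) 0 *
          (1 + (Fin.snoc x t : Fin 2 → ℝ) 1 ^ 2))‖ₑ
        ≤ ∫⁻ _ in Icc (0:ℝ) (x 0), ENNReal.ofReal (1 / x 0) := by
          refine lintegral_mono fun t => ?_
          simp only [hs0, hs1]
          rw [Real.enorm_eq_ofReal (by positivity)]
          refine ENNReal.ofReal_le_ofReal ?_
          rw [one_div_le_one_div (by positivity) hx0]
          nlinarith [sq_nonneg t]
      _ = ‖(1:ℝ)‖ₑ := by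
          rw [setLIntegral_const, Real.volume_Icc, sub_zero,
            ← ENNReal.ofReal_mul (one_div_pos.2 hx0).le, one_div_mul_cancel hx0.ne',
            ENNReal.ofReal_one, enorm_one]
  exact ⟨⟨_, _, hT, hsa, hint⟩, rfl, rfl⟩

/-- **`K' = [wedge {0 < u < 1, u ≤ y ≤ 1}, 1/((1 + u²)y)]` exists**: the wedge is a band over the
open unit interval with `ℚ`-semialgebraic edges `u ≤ y ≤ 1`; the integrand is a quotient of
`ℚ`-polynomials with denominator `(1 + u²)y ≥ y ≥ u > 0` on the wedge; and it is absolutely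
integrable because the wedge lies in the coordinate swap `{0 < y < 1, 0 ≤ u ≤ y}` of the triangle
of `exists_catalanRep_triangle` (on which the swapped integrand `1/(y(1 + u²))` is integrable:
`KZ.IntegralRep.reindex`, rule (2) for a permutation of coordinates) up to the null edge `y = 1`.
[cite: KontsevichZagier2001, §1.2] -/
theorem exists_catalanRep_wedge :
    ∃ K' : IntegralRep 2,
      K'.domain =
          KZlog.band {y : Fin 1 → ℝ | 0 < y 0 ∧ y 0 < 1} (fun y => y 0) (fun _ => (1:ℝ)) ∧
        K'.integrand = fun z => 1 / ((1 + z 0 ^ 2) * z 1) := by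
  obtain ⟨C₁, hC₁d, hC₁i⟩ := exists_catalanRep_triangle
  have hσ : IsSemialgebraic ℚ {y : Fin 1 → ℝ | 0 < y 0 ∧ y 0 < 1} :=
    isSemialgebraic_unitInterval_fin_one
  have hB : IsSemialgebraic ℚ
      (KZlog.band {y : Fin 1 → ℝ | 0 < y 0 ∧ y 0 < 1} (fun y => y 0) (fun _ => (1:ℝ))) :=
    KZlog.isSemialgebraic_band (isSemialgebraicFunOn_apply hσ 0)
      (by simpa using isSemialgebraicFunOn_ratCast hσ 1)
  have hBm : MeasurableSet
      (KZlog.band {y : Fin 1 → ℝ | 0 < y 0 ∧ y 0 < 1} (fun y => y 0) (fun _ => (1:ℝ))) :=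
    Literature.ModelTheory.ExponentialFields.IsSemialgebraic.measurableSet_holds hB
  have hmemB : ∀ w : Fin 2 → ℝ,
      w ∈ KZlog.band {y : Fin 1 → ℝ | 0 < y 0 ∧ y 0 < 1} (fun y => y 0) (fun _ => (1:ℝ)) ↔
        (0 < w 0 ∧ w 0 < 1) ∧ w 0 ≤ w 1 ∧ w 1 ≤ 1 := fun w => Iff.rfl
  have hmemT : ∀ z : Fin 2 → ℝ, z ∈ C₁.domain ↔ (0 < z 0 ∧ z 0 < 1) ∧ 0 ≤ z 1 ∧ z 1 ≤ z 0 :=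
    fun z => by
    rw [hC₁d]
    exact Iff.rfl
  -- the swapped triangle `{0 < w₁ < 1, 0 ≤ w₀ ≤ w₁}` and its integrand `1/(w₁(1 + w₀²))`
  have hmemR : ∀ w : Fin 2 → ℝ, w ∈ (C₁.reindex (Equiv.swap (0 : Fin 2) 1)).domain ↔
      (0 < w 1 ∧ w 1 < 1) ∧ 0 ≤ w 0 ∧ w 0 ≤ w 1 := fun w => by
    rw [IntegralRep.reindex_domain, mem_setOf_eq, hmemT]
    simp only [Equiv.swap_apply_left, Equiv.swap_apply_right]
  have hsub : KZlog.band {y : Fin 1 → ℝ | 0 < y 0 ∧ y 0 < 1} (fun y => y 0) (fun _ => (1:ℝ)) ⊆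
      (C₁.reindex (Equiv.swap (0 : Fin 2) 1)).domain ∪ {w | w 1 = 1} := by
    intro w hw
    have h := (hmemB w).1 hw
    rcases h.2.2.lt_or_eq with h1 | h1
    · exact Or.inl ((hmemR w).2 ⟨⟨h.1.1.trans_le h.2.1, h1⟩, h.1.1.le, h.2.1⟩)
    · exact Or.inr h1
  have hRW : EqOn (C₁.reindex (Equiv.swap (0 : Fin 2) 1)).integrand
      (fun w => 1 / ((1 + w 0 ^ 2) * w 1))
      (KZlog.band {y : Fin 1 → ℝ | 0 < y 0 ∧ y 0 < 1} (fun y => y 0) (fun _ => (1:ℝ))) :=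
    fun w _ => by
      simp only [IntegralRep.reindex_integrand, hC₁i, Equiv.swap_apply_left,
        Equiv.swap_apply_right]
      ring
  have hint : IntegrableOn (fun w : Fin 2 → ℝ => 1 / ((1 + w 0 ^ 2) * w 1))
      (KZlog.band {y : Fin 1 → ℝ | 0 < y 0 ∧ y 0 < 1} (fun y => y 0) (fun _ => (1:ℝ))) :=
    (((C₁.reindex (Equiv.swap (0 : Fin 2) 1)).integrableOn.union (IntegrableOn.of_measure_zero
      (Measure.pi_hyperplane (fun _ => (volume : Measure ℝ)) 1 1))).mono_set hsub).congr_fun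
      hRW hBm
  have hsa : IsSemialgebraicFunOn ℚ
      (KZlog.band {y : Fin 1 → ℝ | 0 < y 0 ∧ y 0 < 1} (fun y => y 0) (fun _ => (1:ℝ)))
      (fun w => 1 / ((1 + w 0 ^ 2) * w 1)) := by
    refine (isSemialgebraicFunOn_aeval_div_aeval hB 1
      ((1 + MvPolynomial.X 0 ^ 2) * MvPolynomial.X 1) fun w hw => ?_).congr fun w _ => by simp
    have h := (hmemB w).1 hw
    have h1 : (0:ℝ) < 1 + w 0 ^ 2 := by positivity
    simp only [map_add, map_mul, map_pow, map_one, MvPolynomial.aeval_X]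
    exact (mul_pos h1 (h.1.1.trans_le h.2.1)).ne'
  exact ⟨⟨_, _, hB, hsa, hint⟩, rfl, rfl⟩

/-- **Stub (Catalan side: existence of the band-box, the triangle and the wedge
representations)** of the layer `CatalanTwoWays`: (i) `C₀ = [band-box, 1/(1 + x²y²)]` (for any
open-box Catalan representation `N`, which is not needed for the construction),
(ii) `C₁ = [{0 < x < 1, 0 ≤ z ≤ x}, 1/(x(1 + z²))]`, (iii) `K' = [{0 < u < 1, u ≤ y ≤ 1},
1/((1 + u²)y)]` exist as honest integral representations.
[cite: KontsevichZagier2001, §1.1] -/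
theorem exists_catalanReps :
    (∀ (N : IntegralRep 2), N.domain = {x | ∀ i, x i ∈ Set.Ioo (0:ℝ) 1} →
      EqOn N.integrand (fun x => 1 / (1 + (x 0 * x 1) ^ 2)) N.domain →
      ∃ C₀ : IntegralRep 2,
        C₀.domain = KZlog.band {y : Fin 1 → ℝ | 0 < y 0 ∧ y 0 < 1} (fun _ => (0:ℝ)) (fun _ => (1:ℝ)) ∧
        C₀.integrand = fun z => 1 / (1 + (z 0 * z 1) ^ 2)) ∧
    (∃ C₁ : IntegralRep 2,
      C₁.domain = KZlog.band {y : Fin 1 → ℝ | 0 < y 0 ∧ y 0 < 1} (fun _ => (0:ℝ)) (fun y => y 0) ∧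
      C₁.integrand = fun z => 1 / (z 0 * (1 + z 1 ^ 2))) ∧
    (∃ K' : IntegralRep 2,
      K'.domain = KZlog.band {y : Fin 1 → ℝ | 0 < y 0 ∧ y 0 < 1} (fun y => y 0) (fun _ => (1:ℝ)) ∧
      K'.integrand = fun z => 1 / ((1 + z 0 ^ 2) * z 1)) := by
  exact ⟨fun _ _ _ => exists_catalanRep_bandBox, exists_catalanRep_triangle,
    exists_catalanRep_wedge⟩

end Summit.KontsevichZagierPeriods.HurwitzMicroSectors.NormalFormPrinciple.PiBox.M2
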